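import Mathlib
import HarnessLib
import Literature.Analysis.FluidPDE.Tao2016AveragedNS.LocalCascadeSolutions
import Literature.Analysis.FluidPDE.Tao2016AveragedNS.RenormalisedCascadeWaves
import Literature.Analysis.FluidPDE.Tao2016AveragedNS.SelfSimilarCascadeBlowup
import Literature.Analysis.FluidPDE.Tao2016AveragedNS.ViscousEternalSolutions
import Literature.Analysis.FluidPDE.Tao2016AveragedNS.BoundedEternalSolutions
import Summits.NavierStokesRegularity.NavierStokesRegularity.Theses.TaoLadderRungTwoBreak
import Summits.NavierStokesRegularity.NavierStokesRegularity.Theorems.TaoLadderRungTwoBreakNoSurvivingEternalViscBddOneSmallActionRung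
import Summits.NavierStokesRegularity.NavierStokesRegularity.Theorems.TaoLadderRungTwoBreakNoSurvivingEternalViscBddOneWeightedGrowth
import Summits.NavierStokesRegularity.NavierStokesRegularity.Theorems.TaoLadderRungTwoBreakNoSurvivingEternalViscBddOneSurvivorEnergyBound
import Summits.NavierStokesRegularity.NavierStokesRegularity.Theorems.TaoLadderRungTwoBreakNoSurvivingEternalViscBddOneSurvivorAmplitudeFloor

/-!
# QUANTITATIVE K1ᵛ(1) ON THE AMPLITUDE SLICE: geometric decay `p_n(σ) ≤ C·qⁿ` of the a=1-weighted shell energy, uniformly in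
# log-time — crux `TaoLadderRungTwoBreak.NoSurvivingEternalViscBddOne` ⟨20419⟩ (children (ρ0) ⟨20451⟩ / (ρ+) ⟨20452⟩)

MODEL lattice ODEs only (Tao 2016 §4, §6.4; cell vocabulary `IsEternalVisc`, `physEnergy`, `wtEnergy`, `EternalSurvivingFwd`); nothing
here is a statement about the Navier–Stokes equations; no stub, crux or summit is closed (`--supports stmt-NavierStokesRegularity-20419`).

`…SurvivorAmplitudeFloor` shows that below the amplitude floor (`7·C_A·B·(Λ²−1) < 4Λ`) a uniformly bounded admissible eternal
solution (any `ν̂ ≥ 0`) is not forward (S₁)-surviving.  The same three estimates (growth law, uniform energy bound, late flux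
starvation) give MORE, without any contradiction argument:
* **`wtEnergy_geometric_decay`** — `∃ C, q < 1: (1+ε₀)ⁿ·E_n(σ) ≤ C·qⁿ` for EVERY shell `n ≥ 0` and EVERY log-time `σ` (the a=1-weighted
  energy `p_n = wtEnergy` of the tree, `wtEnergy_eq`): split at `σ_m(n) = n·λ₁/ρ` with `3.5·log(1+ε₀)·ρ < λ₁ < log θ − log(1+ε₀)` —
  before `σ_m` the growth law gives `D·e^{−n(L₁−λ₁)}`, after `σ_m` starvation adds `4C_AK^{3/2}·(Λ(1+ε₀)e^{−λ₁/ρ})ⁿ`, and for `σ < 0`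
  the crude bound gives `B²(1+ε₀)^{−4n}`;
* `wtEnergy_geometric_decay_inTableClass` (`112·B·(Λ²−1) < Λ`) and the SLICE form `wtEnergy_geometric_decay_onSlice`
  (`0 < ε₀ ≤ min 1 (1/(6944B))`): on every bounded-amplitude slice, below its threshold, the weighted energy of EVERY admissible
  eternal solution decays geometrically in the shell, uniformly in log-time — a quantitative Liouville statement (the crux's
  conclusion `¬ EternalSurvivingFwd` only says `p_n(σ) → 0` along late `(n, σ)`).
HONEST LABEL: (ρ0), (ρ+), ⟨20419⟩ and every NS statement remain OPEN; rung 0.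
-/

noncomputable section

-- the summit and its single sub-problem share the name (CONVENTIONS §1)
set_option linter.dupNamespace false

namespace Summit.NavierStokesRegularity.NavierStokesRegularity.Theorems.NoSurvivingEternalViscBddOne.SurvivorSliceDecay

open Set Filter Topology MeasureTheory
open scoped RealInnerProductSpace
open Literature.Analysis.FluidPDE Literature.Analysis.FluidPDE.TaoCascade
open Summit.NavierStokesRegularity.NavierStokesRegularity.Theses.TaoLadderRungTwoBreak
open Summit.NavierStokesRegularity.NavierStokesRegularity.Theorems.NoSurvivingEternalViscBddOne.SmallAction
open Summit.NavierStokesRegularity.NavierStokesRegularity.Theorems.NoSurvivingEternalViscBddOne.WeightedGrowth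
open Summit.NavierStokesRegularity.NavierStokesRegularity.Theorems.NoSurvivingEternalViscBddOne.SurvivorEnergyBound
open Summit.NavierStokesRegularity.NavierStokesRegularity.Theorems.NoSurvivingEternalViscBddOne.SurvivorAmplitudeFloor

variable {m : ℕ} {ε₀ νh : ℝ} {α : Fin m → Fin m → Fin m → ℤ × ℤ × ℤ → ℝ} {W : ℤ → ℝ → Em m}

/-- **The growth law absorbed into one exponential.**  For `1 < θ < Λ²` and any rate `ρ > (θ−1)·2C_AB/Λ` there is `D > 0` with
`θⁿ·E_n(σ) ≤ D·e^{ρσ}` for all shells `n ≥ 0` and all `σ ≥ 0` (tree `weightedSum_le`, the linear prefactor absorbed by `x ≤ e^{ηx}/η`).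
[cite: Tao2016AveragedNS, §4 Lemma 4.1 (4.8)–(4.10) with (4.3), §6.4; tree `weightedSum_le`] -/
theorem weighted_growth_exp (hε : 0 < ε₀) (hW : IsEternalVisc ε₀ νh α W) (hc : IsCancellingCoeff α)
    {B : ℝ} (hB : ∀ k σ, ‖W k σ‖ ≤ B) {θ : ℝ} (hθ1 : 1 < θ) (hθ2 : θ < bigLam ε₀ ^ 2) {ρ : ℝ}
    (hρ : (θ - 1) * (2 * fluxConst α * (bigLam ε₀)⁻¹ * B) < ρ) :
    ∃ D : ℝ, 0 < D ∧ ∀ (n : ℕ) (σ : ℝ), 0 ≤ σ → θ ^ n * physEnergy ε₀ W n σ ≤ D * Real.exp (ρ * σ) := by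
  have hΛ : 0 < bigLam ε₀ := bigLam_pos (by linarith)
  have hB0 : 0 ≤ B := (norm_nonneg _).trans (hB 0 0)
  have hC0 := fluxConst_nonneg α
  have hθ0 : 0 < θ := by linarith
  set c : ℝ := 2 * fluxConst α * (bigLam ε₀)⁻¹ * B with hcdef
  have hc0 : 0 ≤ c := by positivity
  set η : ℝ := ρ - (θ - 1) * c with hη
  have hη0 : 0 < η := by rw [hη]; linarith
  obtain ⟨A, hA⟩ := exists_physEnergy_le hε hW ⟨B, hB⟩ (-1)
  have hA0 : 0 ≤ A := (physEnergy_nonneg ε₀ W (-1) 0).trans (hA 0)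
  have h1q : 0 < 1 - θ / bigLam ε₀ ^ 2 := by
    rw [sub_pos, div_lt_one (by positivity)]; exact hθ2
  set δ₀ : ℝ := B ^ 2 / (1 - θ / bigLam ε₀ ^ 2) with hδ₀
  have hδ₀0 : 0 ≤ δ₀ := by positivity
  refine ⟨δ₀ + c * A / η + 1, by positivity, fun n σ hσ => ?_⟩
  have h := weightedSum_le hε hW hc hB hθ1.le hθ2 hA n hσ
  simp only [sub_zero, mul_zero, Real.exp_zero, mul_one] at h
  rw [← hcdef, ← hδ₀] at h
  have hsingle : θ ^ n * physEnergy ε₀ W n σ ≤ ∑ i ∈ Finset.range (n + 1), θ ^ i * physEnergy ε₀ W i σ :=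
    Finset.single_le_sum (f := fun i : ℕ => θ ^ i * physEnergy ε₀ W i σ)
      (fun i _ => mul_nonneg (pow_nonneg hθ0.le i) (physEnergy_nonneg ε₀ W _ _))
      (Finset.mem_range.2 (Nat.lt_succ_self n))
  have he1 : 1 ≤ Real.exp (η * σ) := Real.one_le_exp (by positivity)
  have he2 : η * σ ≤ Real.exp (η * σ) := by have := Real.add_one_le_exp (η * σ); linarith
  have hlin : δ₀ + c * A * σ ≤ (δ₀ + c * A / η) * Real.exp (η * σ) := by
    have h3 : c * A * σ ≤ c * A / η * Real.exp (η * σ) := by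
      rw [div_mul_eq_mul_div, le_div_iff₀ hη0]
      have := mul_le_mul_of_nonneg_left he2 (mul_nonneg hc0 hA0)
      linarith
    have h4 : δ₀ ≤ δ₀ * Real.exp (η * σ) := le_mul_of_one_le_right hδ₀0 he1
    linarith
  have hexp : Real.exp (η * σ) * Real.exp ((θ - 1) * c * σ) = Real.exp (ρ * σ) := by
    rw [← Real.exp_add, hη]; ring_nf
  have hE0 : 0 ≤ Real.exp ((θ - 1) * c * σ) := (Real.exp_pos _).le
  calc θ ^ n * physEnergy ε₀ W n σ
      ≤ (δ₀ + c * A * σ) * Real.exp ((θ - 1) * c * σ) := hsingle.trans h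
    _ ≤ (δ₀ + c * A / η) * Real.exp (η * σ) * Real.exp ((θ - 1) * c * σ) :=
        mul_le_mul_of_nonneg_right hlin hE0
    _ = (δ₀ + c * A / η) * Real.exp (ρ * σ) := by rw [mul_assoc, hexp]
    _ ≤ (δ₀ + c * A / η + 1) * Real.exp (ρ * σ) := mul_le_mul_of_nonneg_right (by linarith) (Real.exp_pos _).le

/-- **The rates.**  If `7·C_A·B·(Λ²−1) < 4Λ` then there are a weight `θ ∈ (1, Λ²)`, a rate `ρ > (θ−1)·2C_AB/Λ` and a slope `λ₁` with
`(7/2)·log(1+ε₀)·ρ < λ₁ < log θ − log(1+ε₀)` (the margin at `θ = Λ²` is `log(1+ε₀)·(4 − 7C_AB(Λ²−1)/Λ) > 0`; continuity in `θ`).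
[cite: Tao2016AveragedNS, §4 (4.1) (`Λ = (1+ε₀)^{5/2}`); elementary] -/
theorem exists_rates (hε : 0 < ε₀) {C_A B : ℝ} (hC0 : 0 ≤ C_A) (hB0 : 0 ≤ B)
    (hlt : 7 * C_A * B * (bigLam ε₀ ^ 2 - 1) < 4 * bigLam ε₀) :
    ∃ θ ρ lam : ℝ, 1 < θ ∧ θ < bigLam ε₀ ^ 2 ∧ (θ - 1) * (2 * C_A * (bigLam ε₀)⁻¹ * B) < ρ ∧
      7 / 2 * Real.log (1 + ε₀) * ρ < lam ∧ lam < Real.log θ - Real.log (1 + ε₀) := by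
  have h1ε : 0 < 1 + ε₀ := by linarith
  have hΛ : 0 < bigLam ε₀ := bigLam_pos (by linarith)
  have hΛ1 : 1 < bigLam ε₀ := by unfold bigLam; exact Real.one_lt_rpow (by linarith) (by norm_num)
  have hΛ2 : 1 < bigLam ε₀ ^ 2 := by nlinarith
  set ℓ : ℝ := Real.log (1 + ε₀) with hℓ
  have hℓ0 : 0 < ℓ := Real.log_pos (by linarith)
  have hlogΛ : Real.log (bigLam ε₀) = 5 / 2 * ℓ := by
    rw [hℓ]; unfold bigLam; rw [Real.log_rpow h1ε]
  set c : ℝ := 2 * C_A * (bigLam ε₀)⁻¹ * B with hcdef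
  have hc0 : 0 ≤ c := by positivity
  have hval : 0 < Real.log (bigLam ε₀ ^ 2) - ℓ - 7 / 2 * ℓ * ((bigLam ε₀ ^ 2 - 1) * c) := by
    rw [Real.log_pow, hlogΛ]
    push_cast
    have h1 : (bigLam ε₀ ^ 2 - 1) * c = 2 * (C_A * B * (bigLam ε₀ ^ 2 - 1)) / bigLam ε₀ := by
      rw [hcdef]; field_simp
    have h2 : 7 / 2 * ((bigLam ε₀ ^ 2 - 1) * c) < 4 := by
      rw [h1, show 7 / 2 * (2 * (C_A * B * (bigLam ε₀ ^ 2 - 1)) / bigLam ε₀)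
        = (7 * C_A * B * (bigLam ε₀ ^ 2 - 1)) / bigLam ε₀ by ring, div_lt_iff₀ hΛ]
      linarith
    nlinarith [mul_pos hℓ0 (sub_pos.2 h2)]
  have hcont : ContinuousAt (fun θ => Real.log θ - ℓ - 7 / 2 * ℓ * ((θ - 1) * c)) (bigLam ε₀ ^ 2) := by
    have : bigLam ε₀ ^ 2 ≠ 0 := by positivity
    fun_prop (disch := exact this)
  have hev : ∀ᶠ θ in 𝓝 (bigLam ε₀ ^ 2), 0 < Real.log θ - ℓ - 7 / 2 * ℓ * ((θ - 1) * c) :=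
    hcont.eventually (lt_mem_nhds hval)
  have hev3 : ∀ᶠ θ in 𝓝[<] (bigLam ε₀ ^ 2), θ ∈ Ioo 1 (bigLam ε₀ ^ 2) := Ioo_mem_nhdsLT hΛ2
  have hev2 : ∀ᶠ θ in 𝓝[<] (bigLam ε₀ ^ 2),
      0 < Real.log θ - ℓ - 7 / 2 * ℓ * ((θ - 1) * c) ∧ θ ∈ Ioo 1 (bigLam ε₀ ^ 2) :=
    (hev.filter_mono nhdsWithin_le_nhds).and hev3
  obtain ⟨θ, hθpos, hθ1, hθ2⟩ := hev2.exists
  set L₁ : ℝ := Real.log θ - ℓ with hL₁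
  set r : ℝ := (θ - 1) * c with hr
  have hr0 : 0 ≤ r := mul_nonneg (by linarith) hc0
  set g₀ : ℝ := L₁ - 7 / 2 * ℓ * r with hg₀
  have hg₀0 : 0 < g₀ := hθpos
  set η : ℝ := g₀ / (7 * ℓ) with hη
  have hη0 : 0 < η := by positivity
  set ρ : ℝ := r + η with hρ
  have hkey : 7 / 2 * ℓ * ρ < L₁ := by
    have e1 : 7 / 2 * ℓ * η = g₀ / 2 := by
      rw [hη]; field_simp
    have e2 : 7 / 2 * ℓ * ρ = 7 / 2 * ℓ * r + g₀ / 2 := by rw [hρ, mul_add, e1]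
    rw [e2]; linarith
  refine ⟨θ, ρ, (L₁ + 7 / 2 * ℓ * ρ) / 2, hθ1, hθ2, by rw [hρ, hr]; linarith, by linarith, by rw [hL₁]; linarith⟩

/-- **GEOMETRIC DECAY OF THE WEIGHTED ENERGY BELOW THE AMPLITUDE FLOOR.**  A uniformly bounded (`‖W‖ ≤ B`) admissible eternal
solution (any `ν̂ ≥ 0`) of a CANCELLING table with `7·C_A·B·(Λ²−1) < 4Λ` has `(1+ε₀)ⁿ·E_n(σ) ≤ C·qⁿ` for some `C > 0`, `q ∈ (0,1)`,
all shells `n ≥ 0` and ALL log-times `σ` (growth law until `σ_m(n) = nλ₁/ρ`, late flux starvation after, the crude bound for `σ < 0`).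
[cite: Tao2016AveragedNS, §4 Lemma 4.1 (4.8)–(4.10) with (4.3), the viscous equation before Thm. 4.2, §6.4; this file] -/
theorem wtEnergy_geometric_decay (hε : 0 < ε₀) (hW : IsEternalVisc ε₀ νh α W) (hc : IsCancellingCoeff α)
    {B : ℝ} (hB : ∀ k σ, ‖W k σ‖ ≤ B) (hlt : 7 * fluxConst α * B * (bigLam ε₀ ^ 2 - 1) < 4 * bigLam ε₀) :
    ∃ C q : ℝ, 0 < C ∧ 0 < q ∧ q < 1 ∧
      ∀ (n : ℕ) (σ : ℝ), (1 + ε₀) ^ n * physEnergy ε₀ W n σ ≤ C * q ^ n := by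
  have h1ε : 0 < 1 + ε₀ := by linarith
  have hΛ : 0 < bigLam ε₀ := bigLam_pos (by linarith)
  have hB0 : 0 ≤ B := (norm_nonneg _).trans (hB 0 0)
  have hC0 := fluxConst_nonneg α
  set ℓ : ℝ := Real.log (1 + ε₀) with hℓ
  have hlogΛ : Real.log (bigLam ε₀) = 5 / 2 * ℓ := by
    rw [hℓ]; unfold bigLam; rw [Real.log_rpow h1ε]
  -- the rates, the growth law, the uniform energy bound
  obtain ⟨θ, ρ, lam, hθ1, hθ2, hρ, hlam1, hlam2⟩ := exists_rates hε hC0 hB0 hlt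
  rw [← hℓ] at hlam1 hlam2
  have hθ0 : 0 < θ := by linarith
  have hρ0 : 0 < ρ := lt_of_le_of_lt (mul_nonneg (by linarith) (by positivity)) hρ
  have hℓ0 : 0 < ℓ := Real.log_pos (by linarith)
  have hlam0 : 0 < lam := lt_trans (by positivity) hlam1
  obtain ⟨D, hD0, hgrowth⟩ := weighted_growth_exp hε hW hc hB hθ1 hθ2 hρ
  obtain ⟨K, hK0, hK⟩ := exists_uniform_physEnergy_le hε hW hc ⟨B, hB⟩
  -- the three ratios
  set q₁ : ℝ := Real.exp (-(Real.log θ - ℓ - lam)) with hq₁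
  have hq₁0 : 0 < q₁ := Real.exp_pos _
  have hq₁1 : q₁ < 1 := Real.exp_lt_one_iff.2 (by linarith)
  set q₂ : ℝ := bigLam ε₀ * (1 + ε₀) * Real.exp (-(lam / ρ)) with hq₂
  have hq₂0 : 0 < q₂ := by positivity
  have hq₂1 : q₂ < 1 := by
    have e : q₂ = Real.exp (Real.log (bigLam ε₀) + ℓ - lam / ρ) := by
      rw [Real.exp_sub, Real.exp_add, Real.exp_log hΛ, hℓ, Real.exp_log h1ε, hq₂, Real.exp_neg, div_eq_mul_inv]
      ring
    rw [e]
    refine Real.exp_lt_one_iff.2 ?_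
    rw [hlogΛ]
    have : 7 / 2 * ℓ < lam / ρ := by rw [lt_div_iff₀ hρ0]; linarith
    linarith
  set q₃ : ℝ := ((1 + ε₀) ^ 4)⁻¹ with hq₃
  have hq₃0 : 0 < q₃ := by positivity
  have hq₃1 : q₃ < 1 := inv_lt_one_of_one_lt₀ (one_lt_pow₀ (by linarith : (1:ℝ) < 1 + ε₀) (by norm_num))
  set q : ℝ := max q₁ (max q₂ q₃) with hq
  have hq0 : 0 < q := lt_max_of_lt_left hq₁0
  have hq1 : q < 1 := max_lt hq₁1 (max_lt hq₂1 hq₃1)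
  have hq₁le : q₁ ≤ q := le_max_left _ _
  have hq₂le : q₂ ≤ q := (le_max_left _ _).trans (le_max_right _ _)
  have hq₃le : q₃ ≤ q := (le_max_right _ _).trans (le_max_right _ _)
  have hKK : 0 ≤ 4 * fluxConst α * (K * Real.sqrt K) := by positivity
  set C : ℝ := D + 4 * fluxConst α * (K * Real.sqrt K) + B ^ 2 + K with hCdef
  have hC0' : 0 < C := by positivity
  refine ⟨C, q, hC0', hq0, hq1, fun n σ => ?_⟩
  have hpow : 0 < (1 + ε₀) ^ n := by positivity
  have hθn : 0 < θ ^ n := pow_pos hθ0 n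
  have hqn0 : 0 ≤ q ^ n := pow_nonneg hq0.le n
  rcases lt_or_ge σ 0 with hσ | hσ
  · -- early: crude bound `E_n ≤ Λ^{-2n}B²e^{2σ}`
    have h := physEnergy_le_exp hε hB (n : ℤ) σ
    have h2 : Real.exp (2 * σ) ≤ 1 := by rw [← Real.exp_zero]; exact Real.exp_le_exp.2 (by linarith)
    have e1 : (1 + ε₀) ^ n * ((bigLam ε₀ ^ (n : ℤ))⁻¹ ^ 2) = q₃ ^ n := by
      rw [zpow_natCast, ← inv_pow, ← pow_mul, hq₃]
      have : (bigLam ε₀)⁻¹ ^ (n * 2) = ((bigLam ε₀) ^ 2)⁻¹ ^ n := by rw [inv_pow, inv_pow, ← pow_mul, mul_comm]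
      rw [this, bigLam_sq hε.le, ← mul_pow]
      congr 1
      field_simp
    have hq3n : q₃ ^ n ≤ q ^ n := pow_le_pow_left₀ hq₃0.le hq₃le n
    calc (1 + ε₀) ^ n * physEnergy ε₀ W n σ
        ≤ (1 + ε₀) ^ n * ((bigLam ε₀ ^ (n : ℤ))⁻¹ ^ 2 * B ^ 2 * Real.exp (2 * σ)) :=
          mul_le_mul_of_nonneg_left h hpow.le
      _ = q₃ ^ n * B ^ 2 * Real.exp (2 * σ) := by rw [← e1]; ring
      _ ≤ q ^ n * B ^ 2 * 1 :=
          mul_le_mul (mul_le_mul_of_nonneg_right hq3n (sq_nonneg B)) h2 (Real.exp_pos _).le (by positivity)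
      _ = B ^ 2 * q ^ n := by ring
      _ ≤ C * q ^ n := mul_le_mul_of_nonneg_right (by rw [hCdef]; linarith [hD0.le, hKK, hK0.le]) hqn0
  · -- `σ ≥ 0`: split at `σ_m = n·λ₁/ρ`
    set σm : ℝ := (n : ℝ) * lam / ρ with hσm
    have hσm0 : 0 ≤ σm := by positivity
    have hq1n : q₁ ^ n ≤ q ^ n := pow_le_pow_left₀ hq₁0.le hq₁le n
    have hq2n : q₂ ^ n ≤ q ^ n := pow_le_pow_left₀ hq₂0.le hq₂le n
    -- growth until `σ_m`: `(1+ε₀)ⁿE_n ≤ D q₁ⁿ`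
    have hearly : ∀ s, 0 ≤ s → s ≤ σm → (1 + ε₀) ^ n * physEnergy ε₀ W n s ≤ D * q₁ ^ n := by
      intro s h0 hm
      have h1 := hgrowth n s h0
      have h2 : D * Real.exp (ρ * s) ≤ D * Real.exp (ρ * σm) :=
        mul_le_mul_of_nonneg_left (Real.exp_le_exp.2 (mul_le_mul_of_nonneg_left hm hρ0.le)) hD0.le
      have e1 : ρ * σm = (n : ℝ) * lam := by rw [hσm]; field_simp
      have e2 : (1 + ε₀) ^ n * Real.exp ((n : ℝ) * lam) = θ ^ n * q₁ ^ n := by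
        rw [hq₁, ← mul_pow, Real.exp_nat_mul, ← mul_pow]
        congr 1
        rw [show -(Real.log θ - ℓ - lam) = lam - (Real.log θ - ℓ) by ring, Real.exp_sub, Real.exp_sub,
          Real.exp_log hθ0, hℓ, Real.exp_log h1ε]
        field_simp
      have h3 : θ ^ n * ((1 + ε₀) ^ n * physEnergy ε₀ W n s) ≤ θ ^ n * (D * q₁ ^ n) := by
        calc θ ^ n * ((1 + ε₀) ^ n * physEnergy ε₀ W n s)
            = (1 + ε₀) ^ n * (θ ^ n * physEnergy ε₀ W n s) := by ring
          _ ≤ (1 + ε₀) ^ n * (D * Real.exp (ρ * σm)) := mul_le_mul_of_nonneg_left (h1.trans h2) hpow.le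
          _ = D * ((1 + ε₀) ^ n * Real.exp ((n : ℝ) * lam)) := by rw [e1]; ring
          _ = θ ^ n * (D * q₁ ^ n) := by rw [e2]; ring
      exact le_of_mul_le_mul_left h3 hθn
    rcases le_or_gt σ σm with hcase | hcase
    · calc (1 + ε₀) ^ n * physEnergy ε₀ W n σ ≤ D * q₁ ^ n := hearly σ hσ hcase
        _ ≤ D * q ^ n := mul_le_mul_of_nonneg_left hq1n hD0.le
        _ ≤ C * q ^ n := mul_le_mul_of_nonneg_right (by rw [hCdef]; linarith [hKK, hK0.le, sq_nonneg B]) hqn0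
    · -- after `σ_m`: starvation (shell `n ≥ 1`; shell `0` by the energy bound)
      rcases Nat.eq_zero_or_pos n with hn0 | hnpos
      · subst hn0
        have h1 : physEnergy ε₀ W ((0 : ℕ) : ℤ) σ ≤ K := hK 0 σ
        simp only [pow_zero, one_mul, mul_one]
        rw [hCdef]; linarith [hD0.le, hKK, sq_nonneg B]
      · have h1 := hearly σm hσm0 le_rfl
        have h2 := physEnergy_late_le hε hW hc hK0.le hK (show 1 ≤ n from hnpos) hcase.le
        have hexpm : Real.exp (-σm) = Real.exp (-(lam / ρ)) ^ n := by
          rw [← Real.exp_nat_mul, hσm]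
          congr 1
          field_simp
        have hprod : (1 + ε₀) ^ n * (bigLam ε₀ ^ n * Real.exp (-σm)) = q₂ ^ n := by
          rw [hexpm, hq₂, mul_pow, mul_pow]; ring
        have h3 : (1 + ε₀) ^ n * physEnergy ε₀ W n σ
            ≤ D * q₁ ^ n + 4 * fluxConst α * (K * Real.sqrt K) * q₂ ^ n := by
          calc (1 + ε₀) ^ n * physEnergy ε₀ W n σ
              ≤ (1 + ε₀) ^ n * (physEnergy ε₀ W n σm
                  + 4 * fluxConst α * bigLam ε₀ ^ n * (K * Real.sqrt K) * Real.exp (-σm)) :=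
                mul_le_mul_of_nonneg_left h2 hpow.le
            _ = (1 + ε₀) ^ n * physEnergy ε₀ W n σm
                  + 4 * fluxConst α * (K * Real.sqrt K) * ((1 + ε₀) ^ n * (bigLam ε₀ ^ n * Real.exp (-σm))) := by
                ring
            _ ≤ D * q₁ ^ n + 4 * fluxConst α * (K * Real.sqrt K) * q₂ ^ n := by
                rw [hprod]; linarith
        have h4 : D * q₁ ^ n ≤ D * q ^ n := mul_le_mul_of_nonneg_left hq1n hD0.le
        have h5 : 4 * fluxConst α * (K * Real.sqrt K) * q₂ ^ n ≤ 4 * fluxConst α * (K * Real.sqrt K) * q ^ n :=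
          mul_le_mul_of_nonneg_left hq2n hKK
        calc (1 + ε₀) ^ n * physEnergy ε₀ W n σ
            ≤ D * q ^ n + 4 * fluxConst α * (K * Real.sqrt K) * q ^ n := by linarith
          _ = (D + 4 * fluxConst α * (K * Real.sqrt K)) * q ^ n := by ring
          _ ≤ C * q ^ n := mul_le_mul_of_nonneg_right (by rw [hCdef]; linarith [hK0.le, sq_nonneg B]) hqn0

/-- **The decay in the tree's vocabulary** (`wtEnergy ε₀ W n σ = (1+ε₀)ⁿ·E_n(σ)`, `wtEnergy_eq`): below the amplitude floor the
a=1-weighted shell energy `p_n` of a uniformly bounded admissible eternal solution decays geometrically in `n`, uniformly in log-time.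
[cite: Tao2016AveragedNS, §4 Thm. 4.2 (statement shape), §6.4; this file; tree `wtEnergy_eq`] -/
theorem wtEnergy_le_geometric (hε : 0 < ε₀) {α : Fin 4 → Fin 4 → Fin 4 → ℤ × ℤ × ℤ → ℝ} {W : ℤ → ℝ → Em 4}
    (hW : IsEternalVisc ε₀ νh α W) (hc : IsCancellingCoeff α)
    {B : ℝ} (hB : ∀ k σ, ‖W k σ‖ ≤ B) (hlt : 7 * fluxConst α * B * (bigLam ε₀ ^ 2 - 1) < 4 * bigLam ε₀) :
    ∃ C q : ℝ, 0 < C ∧ 0 < q ∧ q < 1 ∧ ∀ (n : ℕ) (σ : ℝ), wtEnergy ε₀ W n σ ≤ C * q ^ n := by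
  obtain ⟨C, q, hC, hq0, hq1, h⟩ := wtEnergy_geometric_decay hε hW hc hB hlt
  exact ⟨C, q, hC, hq0, hq1, fun n σ => by rw [wtEnergy_eq hε W n σ]; exact h n σ⟩

/-- **On a table of `InTableClass R`** (`C_A ≤ 64`): `112·B·(Λ²−1) < Λ` suffices for the geometric decay of the weighted energy.
[cite: Tao2016AveragedNS, §4 Thm. 4.2 (statement shape), §6.4; this file; tree `fluxConst_le_64`] -/
theorem wtEnergy_geometric_decay_inTableClass {R : ℝ} (hε : 0 < ε₀) {α : Fin 4 → Fin 4 → Fin 4 → ℤ × ℤ × ℤ → ℝ}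
    (hα : InTableClass R α) {W : ℤ → ℝ → Em 4} (hW : IsEternalVisc ε₀ νh α W)
    {B : ℝ} (hB : ∀ k σ, ‖W k σ‖ ≤ B) (hsmall : 112 * B * (bigLam ε₀ ^ 2 - 1) < bigLam ε₀) :
    ∃ C q : ℝ, 0 < C ∧ 0 < q ∧ q < 1 ∧ ∀ (n : ℕ) (σ : ℝ), wtEnergy ε₀ W n σ ≤ C * q ^ n := by
  have hC := fluxConst_le_64 hα
  have hB0 : 0 ≤ B := (norm_nonneg _).trans (hB 0 0)
  have hΛ1 : 1 < bigLam ε₀ := by unfold bigLam; exact Real.one_lt_rpow (by linarith) (by norm_num)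
  have hΛ2 : 0 ≤ bigLam ε₀ ^ 2 - 1 := by nlinarith
  refine wtEnergy_le_geometric hε hW hα.2.1 hB ?_
  have h2 : 7 * fluxConst α * B * (bigLam ε₀ ^ 2 - 1) ≤ 7 * 64 * B * (bigLam ε₀ ^ 2 - 1) := by
    have := mul_le_mul_of_nonneg_right (mul_le_mul_of_nonneg_right hC hB0) hΛ2
    nlinarith
  nlinarith

/-- `(1+ε)⁵ − 1 ≤ 31ε` on `[0,1]`. [folklore] -/
private theorem pow_five_sub_one_le'' {ε : ℝ} (h0 : 0 ≤ ε) (h1 : ε ≤ 1) : (1 + ε) ^ 5 - 1 ≤ 31 * ε := by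
  have h2 : ε ^ 2 ≤ ε := by nlinarith
  have h3 : ε ^ 3 ≤ ε := by nlinarith
  have h4 : ε ^ 4 ≤ ε := by nlinarith
  have h5 : ε ^ 5 ≤ ε := by nlinarith
  nlinarith

/-- **QUANTITATIVE K1ᵛ(1) ON THE AMPLITUDE SLICE.**  For every `B > 0` and ALL `0 < ε₀ ≤ min 1 (1/(6944B))`, all `R`, all tables of
`InTableClass R`, all `ν̂ ≥ 0`: every admissible eternal solution with `sup‖W‖ ≤ B` has geometrically decaying a=1-weighted shell
energy, `wtEnergy ε₀ W n σ ≤ C·qⁿ` (`q < 1`) for all `n ≥ 0` and ALL `σ` — in particular it is not forward (S₁)-surviving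
(`noSurvivingEternalViscBddOne_onSlice`), but the decay holds at every log-time, not only along late `(n, σ)`.
[cite: Tao2016AveragedNS, §4 Thm. 4.2 (statement shape), §6.4; this file] -/
theorem wtEnergy_geometric_decay_onSlice {B : ℝ} (hBpos : 0 < B) :
    ∀ ε₀ : ℝ, 0 < ε₀ → ε₀ ≤ min 1 (1 / (6944 * B)) →
      ∀ (R : ℝ) (α : Fin 4 → Fin 4 → Fin 4 → ℤ × ℤ × ℤ → ℝ), InTableClass R α →
        ∀ (νh : ℝ) (W : ℤ → ℝ → Em 4), IsEternalVisc ε₀ νh α W → (∀ k σ, ‖W k σ‖ ≤ B) →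
          ∃ C q : ℝ, 0 < C ∧ 0 < q ∧ q < 1 ∧ ∀ (n : ℕ) (σ : ℝ), wtEnergy ε₀ W n σ ≤ C * q ^ n := by
  intro ε₀ hε hle R α hα νh W hW hB
  have hε1 : ε₀ ≤ 1 := hle.trans (min_le_left _ _)
  have hεB : ε₀ ≤ 1 / (6944 * B) := hle.trans (min_le_right _ _)
  have hΛ1 : 1 ≤ bigLam ε₀ := one_le_bigLam hε.le
  refine wtEnergy_geometric_decay_inTableClass hε hα hW hB ?_
  rw [bigLam_sq hε.le]
  have h1 : (1 + ε₀) ^ 5 - 1 ≤ 31 * ε₀ := pow_five_sub_one_le'' hε.le hε1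
  have h2 : 112 * B * ((1 + ε₀) ^ 5 - 1) ≤ 112 * B * (31 * ε₀) := mul_le_mul_of_nonneg_left h1 (by positivity)
  have h3 : 6944 * B * ε₀ ≤ 1 := by
    rw [le_div_iff₀ (by positivity)] at hεB
    linarith
  nlinarith

end Summit.NavierStokesRegularity.NavierStokesRegularity.Theorems.NoSurvivingEternalViscBddOne.SurvivorSliceDecay

end
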